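import Summits.HodgeConjecture.HodgeConjecture.Theses.LinearSystemTorelli
import Literature.AlgebraicGeometry.Hyperkaehler.MarkmanRationalHodgeIsometries

/-!
# Line card `hk-endomorphism-trichotomy` — crux stmt-HodgeConjecture-2409 `LinearSystemTorelli.MiddleDivisorSupportFourfold`

crux-plan (opening), planner-cruxplan-stmt-HodgeConjecture-2409-hk-endomorphism-tric-0, 2026-08-16.

## VERDICT: `no-skeleton` for the ∀-fourfold crux — this file is the CHECKED SECTOR SKELETON the idea does support

The crux is `∀ X` (every smooth projective complex fourfold) and is kernel-certified equivalent to
HC(4,2) (`Lines/Sketch.lean` v4, `crux_iff_hc42`; p108510). The idea `hk-endomorphism-trichotomy` is,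
by its own text and by both triage notes (TRIAGE-r1-1/2: "pass — honest SECTOR lever … never a line
concluding the ∀-crux"), a statement about ONE deformation type: projective fourfolds of
`K3^[2]`-type (`Hyperkaehler.IsOfK3HilbertSquareType`). Any composition
`stub₁ → … → stub_k → MiddleDivisorSupportFourfold` built from it must contain a stub implying the
crux OFF the sector — `OffK3SquareSector` below, which is the crux verbatim on the class of all
non-`K3^[2]`-type fourfolds (it contains every other open case of HC(4,2): Calabi–Yau and
general-type hypersurfaces of `ℙ⁵`, `K3 × K3`, generalized-Kummer fourfolds, …). That stub is the
COSTUME / "all difficulty in one step" defect of the crux-plan protocol; `crux_iff_sector_and_off`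
records the (trivial) certificate. Hence no `MiddleDivisorSupportFourfold_of` is offered and no
stub is registered against stmt-2409.

What the idea DOES give is typed here, sorry-free except inside the five `stub_*`, with the two
compositions PROVED:

* `cmOrRationalSector_of : IsometryClassAlgebraic → SelfAdjointEndoClasses → IsometrySpanning →
  CMOrRationalSector` — on a projective `K3^[2]`-type `X` whose transcendental endomorphism field
  `E = End_Hdg(T(X)_ℚ)` is CM or `ℚ`, EVERY rational `(2,2)`-class is ALGEBRAIC (stronger than
  divisor support). Ingredients: Markman 2024 Thm 1.1 (tree fact
  `Hyperkaehler.Markman2024_rationalHodgeIsometry_algebraic`), the isometry-spanning lemma (tree,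
  PROVED on abstract carriers: `Motives.HodgeStructure.span_setOf_isometry_eq_top[_of_conj_ne]`,
  Zarhin `Zarhin1983_adjoint_eq_conj_holds`), Verbitsky–Bogomolov `Sym² H² ≅ H⁴` for `n = 2`
  (Markman 2024 p. 6: "When n = 2 the ring H*(X,ℚ) is generated by H²(X,ℚ)"; `b₄ = 276 =
  dim Sym² ℚ²³`, Göttsche), Charles–Markman 2013 / Markman 2024 §1.2 Lemma 1.6 + Kleiman (dual
  Lefschetz operator and Künneth factors algebraic on projective `K3^[n]`-type), Lefschetz (1,1).
* `k3SquareTypeSector_of : … → BBFData → RealMultiplicationResidue → K3SquareTypeSector` — the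
  crux ON THE SECTOR, by the exhaustive trichotomy CM / `E = ℚ` / real multiplication; the single
  open stub is `stub_realMultiplicationResidue` (= HC(4,2) on the real-multiplication
  Noether–Lefschetz loci of the 20-dimensional `K3^[2]` period space; open even for `S × S`,
  Varesco 2023 p. 3).

The CM / `ℚ` / RM indicators are rendered WITHOUT the transcendental lattice, exactly as the
tree's `Surfaces.HasComplexMultiplication` (file `Surfaces/K3ComplexMultiplication`): through the
scalar by which a rational Hodge endomorphism of `H²(X(ℂ); ℂ)` acts on the line `H^{2,0}`
(`E ↪ ℂ`, Huybrechts *K3* Cor. 3.3.6; `End_Hdg(H²) = End(NS_ℚ) ⊕ E` since `T(X)_ℚ` is irreducible of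
K3 type for projective hyper-Kähler `X`, Lemma 3.3.1 verbatim with the BBF form). Hodge
isometries and the classes `c_φ = Σᵢ φ(eᵢ) ∪ eᵢ^∨` use Beauville's form `beauvilleBilin /
beauvilleForm` of a normalised datum `(μ, σ)` (file `Hyperkaehler/BeauvilleBogomolovForm`), the
carriers of Markman's fact.

Use: (i) `CMOrRationalSector` / `K3SquareTypeSector` are ready-to-file SUPPORT statements
(`--supports stmt-HodgeConjecture-2409`; signatures elaborate here); (ii) if a planner files
`K3SquareTypeSector` as an item, this file is its skeleton (4 provable stubs + 1 open); (iii) the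
negative item stmt-2413 `UnsupportedHodgeClassFourfold` is sharpened on this deformation type to
"real multiplication" (`realMultiplicationResidue_of_crux`).
-/

namespace Summit.HodgeConjecture.HodgeConjecture.Cruxes.MiddleDivisorSupportFourfold.HkEndomorphismTrichotomy

open Literature.AlgebraicGeometry Literature.AlgebraicGeometry.HodgeTheory
open Literature.AlgebraicGeometry.Hyperkaehler
open Literature.AlgebraicTopology.SingularHomology
open scoped BigOperators

/-- Degree bookkeeping `H² ∪ H² → H⁴`. -/
theorem h22 : (2 : ℕ) + 2 = 4 := rfl

/-- Real dimension bookkeeping for Beauville's form on a fourfold: `4 · n = 2 · dim_ℂ`, `n = 2`. -/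
theorem hdim : (4 : ℕ) * 2 = 2 * 4 := rfl

section Vocabulary

variable (X : Motives.SchemeOver ℂ)

/-- A **rational Hodge endomorphism** of `H²(X(ℂ); ℂ)` (`X` a fourfold): `ℂ`-linear, rational
classes to rational classes, `(i,j)`-classes to `(i,j)`-classes — the rendering of Markman's fact and
of `Surfaces.HasComplexMultiplication` (`ψ_ℚ ⊗ ℂ` for `ψ_ℚ ∈ End_Hdg(H²(X, ℚ))`).
[cite: Huybrechts2016K3, §3.3.5] -/
def IsRationalHodgeEndo (φ : complexBetti X 2 →ₗ[ℂ] complexBetti X 2) : Prop :=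
  (∀ x, IsRationalClass x → IsRationalClass (φ x)) ∧
    ∀ (i j : ℕ) (x : complexBetti X 2), IsOfHodgeType 4 X 2 i j x → IsOfHodgeType 4 X 2 i j (φ x)

/-- **CM indicator**: `E = End_Hdg(T(X)_ℚ)` is a CM field — some rational Hodge endomorphism of `H²`
acts on a non-zero `(2,0)`-class by a NON-REAL scalar (verbatim the tree's
`Surfaces.HasComplexMultiplication`, weight/dimension parameters of a fourfold; `E ↪ ℂ` through
`H^{2,0}`, and `E` is totally real or CM by Zarhin, so CM ⟺ a non-real value occurs).
[cite: Huybrechts2019, Rem. 3.3] [cite: Zarhin1983HodgeGroupsK3, Thm. 1.5.1] -/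
def HasComplexMultiplication : Prop :=
  ∃ φ : complexBetti X 2 →ₗ[ℂ] complexBetti X 2, IsRationalHodgeEndo X φ ∧
    ∃ (σ : complexBetti X 2) (μ : ℂ), IsOfHodgeType 4 X 2 2 0 σ ∧ σ ≠ 0 ∧ μ.im ≠ 0 ∧ φ σ = μ • σ

/-- **`E = ℚ` indicator**: every rational Hodge endomorphism of `H²` acts on every non-zero
`(2,0)`-class by a RATIONAL scalar (`E ↪ ℂ` is injective with image `ε(E)`, so `ε(E) ⊆ ℚ ⟺ E = ℚ`).
[cite: Huybrechts2016K3, Cor. 3.3.6] -/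
def HasRationalEndomorphismField : Prop :=
  ∀ φ : complexBetti X 2 →ₗ[ℂ] complexBetti X 2, IsRationalHodgeEndo X φ →
    ∀ σ : complexBetti X 2, IsOfHodgeType 4 X 2 2 0 σ → σ ≠ 0 → ∃ r : ℚ, φ σ = (r : ℂ) • σ

/-- **Real-multiplication indicator** (the residual case of the trichotomy): neither CM nor `ℚ`,
i.e. `E` totally real with `[E : ℚ] ≥ 2`. [cite: vanGeemen2008RealMultK3, §2] -/
def HasRealMultiplication : Prop :=
  ¬ HasComplexMultiplication X ∧ ¬ HasRationalEndomorphismField X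

variable {X}

/-- A **Beauville datum** on the smooth projective fourfold `X`: an orientation family `μ` and a
non-zero `(2,0)`-class `σ` normalised à la Beauville, `⟨σ² ⌣ σ̄², [X(ℂ)]_μ⟩ = 1` — exactly the
hypotheses under which `beauvilleForm (μ hX) σ 2 _` is (a fixed positive multiple of) the
Beauville–Bogomolov–Fujiki form and Markman's fact applies. Existence = `stub_bbfData`.
[cite: Beauville1983, §8 p. 772 and Thm. 5 (a)] -/
def IsBBFDatum (hX : Motives.IsSmoothProjective 4 X) (μ : OrientationFamily)
    (σ : complexBetti X 2) : Prop :=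
  IsOfHodgeType 4 X 2 2 0 σ ∧ σ ≠ 0 ∧ IsBeauvilleNormalised (μ hX) σ 2 hdim

/-- A **dual basis pair** for Beauville's bilinear form `B = beauvilleBilin (μ hX) σ 2 _`: a
`ℂ`-basis `e` of `H²(X(ℂ); ℂ)` and the family `f` with `B(eᵢ, fⱼ) = δᵢⱼ` (it exists iff `B` is
non-degenerate — Beauville Thm. 5 (a) — and is then unique). [cite: Beauville1983, Thm. 5 (a)] -/
def IsDualPair (hX : Motives.IsSmoothProjective 4 X) (μ : OrientationFamily) (σ : complexBetti X 2)
    {k : ℕ} (e : Module.Basis (Fin k) ℂ (complexBetti X 2)) (f : Fin k → complexBetti X 2) : Prop :=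
  ∀ i j : Fin k, beauvilleBilin (μ hX) σ 2 hdim (e i) (f j) = if i = j then 1 else 0

/-- **The class `c_φ := Σᵢ φ(eᵢ) ∪ fᵢ ∈ H⁴(X(ℂ); ℂ)`** of an endomorphism `φ` of `H²` with respect to a
dual basis pair: the image of `φ` under `End(H²) ≅ H² ⊗ H²` (via `B`) followed by the cup product
`H² ⊗ H² → H⁴`; `c_{id} = q_B^∨` is the dual Beauville–Bogomolov class, and for `φ` a Hodge
endomorphism `c_φ` is a rational `(2,2)`-class. [cite: Markman2011BBClass, §1.1] -/
noncomputable def endoClass {k : ℕ} (e : Module.Basis (Fin k) ℂ (complexBetti X 2))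
    (f : Fin k → complexBetti X 2) (φ : complexBetti X 2 →ₗ[ℂ] complexBetti X 2) :
    complexBetti X 4 :=
  ∑ i : Fin k, cupProduct h22 (φ (e i)) (f i)

/-- A **rational Hodge isometry** of `(H²(X(ℂ); ℂ), q)` for the Beauville datum `(μ, σ)`: bijective,
rational Hodge, and preserving Beauville's quadratic form — verbatim the hypotheses on `f` in
`Hyperkaehler.Markman2024_rationalHodgeIsometry_algebraic` with `X = Y`, `σX = σY = σ`.
[cite: Markman2024, Thm. 1.1] -/
def IsRationalHodgeIsometry (hX : Motives.IsSmoothProjective 4 X) (μ : OrientationFamily)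
    (σ : complexBetti X 2) (g : complexBetti X 2 →ₗ[ℂ] complexBetti X 2) : Prop :=
  Function.Bijective g ∧ IsRationalHodgeEndo X g ∧
    ∀ x, beauvilleForm (μ hX) σ 2 hdim (g x) = beauvilleForm (μ hX) σ 2 hdim x

end Vocabulary

/-! ### The sector and its complement (certificate for the `no-skeleton` verdict) -/

/-- **The crux ON the `K3^[2]`-type sector** (verbatim `Lines/Sketch_ideator1.lean`
`DefectSheaf.K3SquareTypeSector`): every rational `(2,2)`-class on a smooth projective fourfold of
`K3^[2]`-type is supported on a divisor. [cite: Markman2024, Thm. 1.1] -/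
def K3SquareTypeSector : Prop :=
  ∀ ⦃X : Motives.SchemeOver ℂ⦄, IsOfK3HilbertSquareType X → Motives.IsSmoothProjective 4 X →
    ∀ c : complexBetti X 4, IsRationalClass c → IsOfHodgeType 4 X 4 2 2 c →
      c ∈ supportedClasses X 4 1

/-- **The crux OFF the sector** — the statement any concluding skeleton built on this idea would have
to carry as a stub: HC(4,2) in support form for every smooth projective fourfold NOT of
`K3^[2]`-type. It is the crux restricted to a class containing all its other open cases (COSTUME).
[cite: Thomas2005Nodes, Thm. 1] -/
def OffK3SquareSector : Prop :=
  ∀ ⦃X : Motives.SchemeOver ℂ⦄, ¬ IsOfK3HilbertSquareType X → Motives.IsSmoothProjective 4 X →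
    ∀ c : complexBetti X 4, IsRationalClass c → IsOfHodgeType 4 X 4 2 2 c →
      c ∈ supportedClasses X 4 1

/-- **Certificate**: the crux is literally the conjunction of the sector statement and its off-sector
complement, so a line from this (sector) idea concludes the crux only through `OffK3SquareSector`.
[cite: Thomas2005Nodes, Thm. 1] -/
theorem crux_iff_sector_and_off :
    Summit.HodgeConjecture.HodgeConjecture.Theses.LinearSystemTorelli.MiddleDivisorSupportFourfold ↔
      K3SquareTypeSector ∧ OffK3SquareSector := by
  constructor
  · intro h
    exact ⟨fun X _ hX c hc hh => h hX c hc hh, fun X _ hX c hc hh => h hX c hc hh⟩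
  · rintro ⟨hS, hO⟩ X hX c hc hh
    by_cases hK : IsOfK3HilbertSquareType X
    · exact hS hK hX c hc hh
    · exact hO hK hX c hc hh

/-- Sanity: the sector statement is an instance of the crux. [cite: Markman2024, Thm. 1.1] -/
theorem k3SquareTypeSector_of_crux
    (h : Summit.HodgeConjecture.HodgeConjecture.Theses.LinearSystemTorelli.MiddleDivisorSupportFourfold) :
    K3SquareTypeSector :=
  (crux_iff_sector_and_off.1 h).1

/-! ### The four sector statements of the trichotomy and the residue -/

/-- **S1 — isometry classes are algebraic** (the MOVE of the card, step (b)). For `X` projective of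
`K3^[2]`-type, a Beauville datum `(μ, σ)`, a `B`-dual basis pair `(e, f)` and a rational Hodge
ISOMETRY `g` of `(H², q)`, the class `c_g = Σᵢ g(eᵢ) ∪ fᵢ` is algebraic. Route: Markman 2024 Thm 1.1
gives an algebraic `Z` on `X × X` with `[Z]_* = g` on `H²` (tree fact
`Markman2024_rationalHodgeIsometry_algebraic`, `n = 2`); the class `Q₁₂ = Σᵢ eᵢ ⊠ fᵢ ∈ H² ⊗ H² ⊂
H⁴(X × X)` is algebraic because the dual Lefschetz operator / the Künneth factors of `Δ` are
algebraic on projective `K3^[n]`-type (Charles–Markman 2013; Markman 2024 §1.2 Lemma 1.6 and p. 39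
"μ_t is algebraic … by [charles-markman] … [kleiman]") and `∫ q^∨ x y ∝ q(x,y)` (generalized
Fujiki); then `(Z × Δ)_* Q₁₂ = Σ g(eᵢ) ⊠ fᵢ` is algebraic and `c_g = Δ^*` of it. Size L (correspondence
calculus on carriers: `ComplexBettiKunneth`, `corrAction`). Why it might fail: only through a
rendering slip (orientation units / the non-symmetrised `beauvilleBilin`), not mathematically.
[cite: Markman2024, Thm. 1.1 and §1.2 Lemma 1.6] [cite: CharlesMarkman2013, Thm. 1.1] -/
def IsometryClassAlgebraic : Prop :=
  ∀ ⦃X : Motives.SchemeOver ℂ⦄, IsOfK3HilbertSquareType X →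
    ∀ (hX : Motives.IsSmoothProjective 4 X) (μ : OrientationFamily) (σ : complexBetti X 2),
      IsBBFDatum hX μ σ →
      ∀ (k : ℕ) (e : Module.Basis (Fin k) ℂ (complexBetti X 2)) (f : Fin k → complexBetti X 2),
        IsDualPair hX μ σ e f →
        ∀ g : complexBetti X 2 →ₗ[ℂ] complexBetti X 2, IsRationalHodgeIsometry hX μ σ g →
          endoClass e f g ∈ algebraicClasses X 2

/-- **S2 — Hodge classes of `H⁴` are classes of self-adjoint Hodge endomorphisms of `H²`**
(Verbitsky–Bogomolov + Göttsche: cup product `Sym² H²(X, ℚ) → H⁴(X, ℚ)` is an ISOMORPHISM of Hodge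
structures for `K3^[2]`-type, `b₄ = 276 = dim Sym² ℚ²³`; `H² ⊗ H² ≅ End(H²)(-2)` via `B`, symmetric
tensors ↔ `B`-self-adjoint endomorphisms, Hodge classes ↔ Hodge endomorphisms). For every rational
`(2,2)`-class `c ∈ H⁴` there is a rational Hodge endomorphism `φ` of `H²`, self-adjoint for
Beauville's bilinear form, with `c = c_φ`. Size M (needs the `Sym²`-isomorphism as a named fact and
the `ℚ`-structure bookkeeping `H^k(X(ℂ); ℂ) = H^k(X, ℚ) ⊗ ℂ`). Why it might fail: rendering only
(`beauvilleBilin` is the printed, non-symmetrised formula; mathematically symmetric).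
[cite: Markman2024, §1.3 p. 6 ("When n = 2 the ring H*(X,ℚ) is generated by H²")] [cite: Verbitsky1996, Thm. 1.5] -/
def SelfAdjointEndoClasses : Prop :=
  ∀ ⦃X : Motives.SchemeOver ℂ⦄, IsOfK3HilbertSquareType X →
    ∀ (hX : Motives.IsSmoothProjective 4 X) (μ : OrientationFamily) (σ : complexBetti X 2),
      IsBBFDatum hX μ σ →
      ∀ (k : ℕ) (e : Module.Basis (Fin k) ℂ (complexBetti X 2)) (f : Fin k → complexBetti X 2),
        IsDualPair hX μ σ e f →
        ∀ c : complexBetti X 4, IsRationalClass c → IsOfHodgeType 4 X 4 2 2 c →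
          ∃ φ : complexBetti X 2 →ₗ[ℂ] complexBetti X 2, IsRationalHodgeEndo X φ ∧
            (∀ x y, beauvilleBilin (μ hX) σ 2 hdim (φ x) y = beauvilleBilin (μ hX) σ 2 hdim x (φ y)) ∧
            c = endoClass e f φ

/-- **S3 — isometry spanning (the CM / `ℚ` dichotomy step; Zarhin + Huybrechts' unitary trick +
Lefschetz (1,1))**. If `E` is CM or `ℚ`, then for every rational Hodge endomorphism `φ` of `H²` there
are rational Hodge ISOMETRIES `g₁, …, g_m` and scalars `a_j` with `c_φ - Σ a_j c_{g_j}` ALGEBRAIC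
(indeed in the span of products of divisor classes). Proof plan: `H²_ℚ = NS ⊕ T` (`q`-orthogonal,
`T` irreducible of K3 type), `End_Hdg(H²_ℚ) = End(NS) ⊕ E`; CM ⟹ `E = span_ℚ {u : u ū = 1}` — PROVED
in the tree on abstract carriers, `Motives.HodgeStructure.span_setOf_isometry_eq_top_of_conj_ne`
(with `Zarhin1983_adjoint_eq_conj_holds`) — and each `id_NS ⊕ u` is a rational Hodge isometry of
`H²`; `E = ℚ` ⟹ `φ|_T = a · id`; in both cases `ψ := φ - Σ a_j g_j` kills `T` and maps into `NS`,
so `c_ψ ∈ ⌣(NS ⊗ NS) ⊆ algebraicClasses X 2` (`lefschetzOneOne_rational`, cup of divisor classes).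
Size M (the bridge "`T(X)_ℚ` with `B|_T` is a polarized irreducible `Motives.HodgeStructure` of K3
type" from the carriers is the work). Why it might fail: not mathematically; the bridge to the
abstract `HodgeStructure` API may force restating the indicator via `Polarization`.
[cite: Huybrechts2016K3, Lemma 3.3.1, Cor. 3.3.6, Thm. 3.3.7] [cite: Buskin2019, Corollary after Thm. 1.1] [cite: Huybrechts2019, Rem. 3.3] -/
def IsometrySpanning : Prop :=
  ∀ ⦃X : Motives.SchemeOver ℂ⦄, IsOfK3HilbertSquareType X →
    ∀ (hX : Motives.IsSmoothProjective 4 X) (μ : OrientationFamily) (σ : complexBetti X 2),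
      IsBBFDatum hX μ σ →
      ∀ (k : ℕ) (e : Module.Basis (Fin k) ℂ (complexBetti X 2)) (f : Fin k → complexBetti X 2),
        IsDualPair hX μ σ e f →
        (HasComplexMultiplication X ∨ HasRationalEndomorphismField X) →
        ∀ φ : complexBetti X 2 →ₗ[ℂ] complexBetti X 2, IsRationalHodgeEndo X φ →
          ∃ (m : ℕ) (g : Fin m → (complexBetti X 2 →ₗ[ℂ] complexBetti X 2)) (a : Fin m → ℂ),
            (∀ j, IsRationalHodgeIsometry hX μ σ (g j)) ∧
            endoClass e f φ - ∑ j : Fin m, a j • endoClass e f (g j) ∈ algebraicClasses X 2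

/-- **BBF data exist** (non-vacuity of S1–S3 and of Markman's fact): a projective fourfold of
`K3^[2]`-type carries an orientation family and a normalised non-zero `(2,0)`-class (`h^{2,0} = 1`,
`∫ (σσ̄)² > 0` for the complex orientation), and Beauville's form of that datum is non-degenerate on
the finite-dimensional `H²(X(ℂ); ℂ)` (Beauville Thm. 5 (a): signature `(3, b₂ - 3)`, `b₂ = 23`), so a
dual basis pair exists. Size S given the facts (Beauville Thm. 5 (a), existence of the symplectic
class, `b₂ < ∞`); a named-fact debt, shared with every consumer of
`Markman2024_rationalHodgeIsometry_algebraic`. [cite: Beauville1983, §8 and Thm. 5 (a)] [cite: Huybrechts1999, §1.9] -/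
def BBFData : Prop :=
  ∀ ⦃X : Motives.SchemeOver ℂ⦄, IsOfK3HilbertSquareType X →
    ∀ hX : Motives.IsSmoothProjective 4 X,
      ∃ (μ : OrientationFamily) (σ : complexBetti X 2), IsBBFDatum hX μ σ ∧
        ∃ (k : ℕ) (e : Module.Basis (Fin k) ℂ (complexBetti X 2)) (f : Fin k → complexBetti X 2),
          IsDualPair hX μ σ e f

/-- **T2 — THE OPEN RESIDUE: real multiplication.** The crux on projective `K3^[2]`-type fourfolds
whose transcendental endomorphism field is totally real `≠ ℚ`: the `[E : ℚ] - 1` classes `c_φ`,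
`φ ∈ E ∖ ℚ`, are supported on a divisor (for `E = ℚ(√d)`: the class of the rational
self-similitude `√d` of `(T, q)`). Open — HC-hard on these Noether–Lefschetz loci, open already for
`S × S` (Varesco 2023 p. 3: `√d` algebraic only on 1-dimensional families); `b₂ = 23` odd forbids the
K3-surface twin-similitude tricks verbatim (card, "Why it bites (2)"). An honest weakening of the
crux (`realMultiplicationResidue_of_crux`), NOT a restatement: it is the crux on a countable union
of positive-codimension loci of one 20-dimensional period space.
[cite: Varesco2023, p. 3 and Thm. 2.1] [cite: vanGeemen2008RealMultK3, §2] -/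
def RealMultiplicationResidue : Prop :=
  ∀ ⦃X : Motives.SchemeOver ℂ⦄, IsOfK3HilbertSquareType X → Motives.IsSmoothProjective 4 X →
    ¬ HasComplexMultiplication X → ¬ HasRationalEndomorphismField X →
      ∀ c : complexBetti X 4, IsRationalClass c → IsOfHodgeType 4 X 4 2 2 c →
        c ∈ supportedClasses X 4 1

/-- **T1-aux — the theorem-candidate of the card with its auxiliary data exposed**: for a Beauville
datum `(μ, σ)` and a `B`-dual basis pair `(e, f)` (universally quantified; they exist, `BBFData`, and
the conclusion does not mention them), on the CM-or-`ℚ` sub-sector every rational `(2,2)`-class is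
ALGEBRAIC. Derived below from S1–S3 (`cmOrRationalSectorAux_of`).
[cite: Markman2024, Thm. 1.1] [cite: Huybrechts2019, Cor. 0.4 (ii) and Rem. 3.3] -/
def CMOrRationalSectorAux : Prop :=
  ∀ ⦃X : Motives.SchemeOver ℂ⦄, IsOfK3HilbertSquareType X →
    ∀ (hX : Motives.IsSmoothProjective 4 X) (μ : OrientationFamily) (σ : complexBetti X 2),
      IsBBFDatum hX μ σ →
      ∀ (k : ℕ) (e : Module.Basis (Fin k) ℂ (complexBetti X 2)) (f : Fin k → complexBetti X 2),
        IsDualPair hX μ σ e f →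
        (HasComplexMultiplication X ∨ HasRationalEndomorphismField X) →
        ∀ c : complexBetti X 4, IsRationalClass c → IsOfHodgeType 4 X 4 2 2 c →
          c ∈ algebraicClasses X 2

/-- **T1 — THE SUPPORT STATEMENT THIS CARD DELIVERS (ready to file, `--supports stmt-2409`): on a
smooth projective fourfold of `K3^[2]`-type whose transcendental endomorphism field is CM or `ℚ`,
every rational `(2,2)`-class is ALGEBRAIC** — the `K3^[2]`-type analogue of Buskin's corollary /
Huybrechts 2019 Cor. 0.4 (ii) (tree: `Surfaces.Buskin2019_hodgeConjectureFor_square_of_CM` for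
`S × S`), with Markman 2024 in place of Buskin and `Sym² H² = H⁴` in place of Künneth. Not found in
print for `K3^[2]`-type `H⁴` (triage F2: Markman 2024 states no CM corollary; Varesco 2023 treats
`S × S` and Kummer type). Derived from S1–S3 + `BBFData` (`cmOrRationalSector_of`).
[cite: Markman2024, Thm. 1.1] [cite: Huybrechts2019, Cor. 0.4 (ii) and Rem. 3.3] [cite: Buskin2019, Corollary after Thm. 1.1] -/
def CMOrRationalSector : Prop :=
  ∀ ⦃X : Motives.SchemeOver ℂ⦄, IsOfK3HilbertSquareType X → Motives.IsSmoothProjective 4 X →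
    (HasComplexMultiplication X ∨ HasRationalEndomorphismField X) →
      ∀ c : complexBetti X 4, IsRationalClass c → IsOfHodgeType 4 X 4 2 2 c →
        c ∈ algebraicClasses X 2

/-! ### Stubs (sector skeleton; NOT registered against stmt-2409 — see the verdict above) -/

/-- S1, load-bearing provable stub (L). [cite: Markman2024, Thm. 1.1 and §1.2] -/
theorem stub_isometryClassAlgebraic : IsometryClassAlgebraic := by
  sorry

/-- S2 (M). [cite: Markman2024, §1.3 p. 6] -/
theorem stub_selfAdjointEndoClasses : SelfAdjointEndoClasses := by
  sorry

/-- S3 (M). [cite: Huybrechts2016K3, Thm. 3.3.7] -/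
theorem stub_isometrySpanning : IsometrySpanning := by
  sorry

/-- Existence of Beauville data (S, named-fact debt). [cite: Beauville1983, Thm. 5 (a)] -/
theorem stub_bbfData : BBFData := by
  sorry

/-- T2, the open residue (real multiplication) — the HARDEST stub. [cite: Varesco2023, p. 3] -/
theorem stub_realMultiplicationResidue : RealMultiplicationResidue := by
  sorry

/-! ### Compositions (proved) -/

/-- **S1 ∧ S2 ∧ S3 ⟹ T1-aux**: `c = c_φ` (S2), `c_φ = (c_φ - Σ a_j c_{g_j}) + Σ a_j c_{g_j}` with the
first summand algebraic by S3 and each `c_{g_j}` algebraic by S1.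
[cite: Huybrechts2019, Rem. 3.3] [cite: Markman2024, Thm. 1.1] -/
theorem cmOrRationalSectorAux_of (h1 : IsometryClassAlgebraic) (h2 : SelfAdjointEndoClasses)
    (h3 : IsometrySpanning) : CMOrRationalSectorAux := by
  intro X hK hX μ σ hd k e f hef hE c hc hh
  obtain ⟨φ, hφ, _hsa, rfl⟩ := h2 hK hX μ σ hd k e f hef c hc hh
  obtain ⟨m, g, a, hg, hmem⟩ := h3 hK hX μ σ hd k e f hef hE φ hφ
  have hsum : (∑ j : Fin m, a j • endoClass e f (g j)) ∈ algebraicClasses X 2 :=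
    Submodule.sum_mem _ fun j _ => Submodule.smul_mem _ _ (h1 hK hX μ σ hd k e f hef (g j) (hg j))
  have key := Submodule.add_mem _ hmem hsum
  rwa [sub_add_cancel] at key

/-- **S1 ∧ S2 ∧ S3 ∧ BBFData ⟹ T1** (choose a Beauville datum and a dual pair, then T1-aux).
[cite: Markman2024, Thm. 1.1] [cite: Beauville1983, Thm. 5 (a)] -/
theorem cmOrRationalSector_of (h1 : IsometryClassAlgebraic) (h2 : SelfAdjointEndoClasses)
    (h3 : IsometrySpanning) (hB : BBFData) : CMOrRationalSector := by
  intro X hK hX hE c hc hh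
  obtain ⟨μ, σ, hd, k, e, f, hef⟩ := hB hK hX
  exact cmOrRationalSectorAux_of h1 h2 h3 hK hX μ σ hd k e f hef hE c hc hh

/-- **T1 ∧ T2 ⟹ the crux ON THE SECTOR** (exhaustive trichotomy: either `E` is CM or `ℚ` — then
T1 and `algebraicClasses X 2 = N² H⁴ ≤ N¹ H⁴` — or `X` has real multiplication — then T2).
[cite: Zarhin1983HodgeGroupsK3, Thm. 1.5.1] -/
theorem k3SquareTypeSector_of_sectors (hT : CMOrRationalSector) (hR : RealMultiplicationResidue) :
    K3SquareTypeSector := by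
  intro X hK hX c hc hh
  by_cases hE : HasComplexMultiplication X ∨ HasRationalEndomorphismField X
  · exact supportedClasses_mono X 4 (by norm_num : (1 : ℕ) ≤ 2) (hT hK hX hE c hc hh)
  · rw [not_or] at hE
    exact hR hK hX hE.1 hE.2 c hc hh

/-- **The sector skeleton composes**: S1, S2, S3, the existence of Beauville data and the
real-multiplication residue give `K3SquareTypeSector`. [cite: Markman2024, Thm. 1.1]
[cite: Zarhin1983HodgeGroupsK3, Thm. 1.5.1] -/
theorem k3SquareTypeSector_of (h1 : IsometryClassAlgebraic) (h2 : SelfAdjointEndoClasses)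
    (h3 : IsometrySpanning) (hB : BBFData) (hR : RealMultiplicationResidue) :
    K3SquareTypeSector :=
  k3SquareTypeSector_of_sectors (cmOrRationalSector_of h1 h2 h3 hB) hR

/-- Sanity: the residue T2 is an honest WEAKENING of the crux (the crux restricted to
real-multiplication `K3^[2]`-type fourfolds), so refuters of stmt-2413 on this deformation type must
look at real multiplication. [cite: Varesco2023, p. 3] -/
theorem realMultiplicationResidue_of_crux
    (h : Summit.HodgeConjecture.HodgeConjecture.Theses.LinearSystemTorelli.MiddleDivisorSupportFourfold) :
    RealMultiplicationResidue :=
  fun _ _ hX _ _ c hc hh => h hX c hc hh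

end Summit.HodgeConjecture.HodgeConjecture.Cruxes.MiddleDivisorSupportFourfold.HkEndomorphismTrichotomy
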